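import Literature.Probability.LatticeModels.SphereReflectionPositivityNecessity

/-!
# Neeb–Ólafsson 2014, Prop. 6.2 — proofs II: sufficiency (`s = 0`; `n = 1, 2`), assembly

Second proof file for the named fact `neebOlafsson2014_ballKernel_posSemidef_iff`
(K.-H. Neeb, G. Ólafsson, *Reflection positivity and conformal symmetry*, J. Funct. Anal. 266
(2014) 2174–2224 = arXiv:1206.2039, §6.2 Prop. 6.2 / Example 6.4): the ball kernel
`R_s(x, y) = (1 − 2⟨x, y⟩ + ‖x‖²‖y‖²)^{−s/2}` is positive definite on the unit ball of `ℝⁿ` iff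
`s = 0` or `s ≥ n − 2`. Proved here (elementary, via Mathlib's binomial series
`Real.one_div_one_sub_rpow_hasFPowerSeriesOnBall_zero` and its complex version):

* `ballKernel_posSemidef_exponent_zero`: `s = 0` (the all-ones matrix);
* `ballKernel_posSemidef_dim_one`: `n = 1`, every `s ≥ 0` — the base is `(1 − t_a t_b)²`, the
  kernel `(1 − t_a t_b)^{−s} = Σ_k multichoose(s, k) (t_a t_b)^k`, a nonnegative combination of
  Gram kernels (Neeb–Ólafsson Example 2.3: `x^{−s}` is positive definite on `ℝ₊`);
* `ballKernel_posSemidef_dim_two`: `n = 2`, every `s ≥ 0` — in the complex coordinate the base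
  is `|1 − z_a \bar z_b|²`, the kernel `|g(z_a \bar z_b)|²` with
  `g = (1 − ·)^{−s/2} = Σ_k multichoose(s/2, k)(·)^k`, and `g \bar g` expands into a nonnegative
  combination of real Gram kernels (`posSemidef_norm_one_sub_mul_conj_rpow`; Example 6.4);
* `neebOlafsson2014_ballKernel_posSemidef_iff_of_le_two`: the fact for `n ≤ 2`, both
  directions; `neebOlafsson2014_ballKernel_posSemidef_iff_of_dim_ge_three_sufficiency`: the
  assembly — the fact follows from sufficiency in dimensions `n ≥ 3` (`s ≥ n − 2`), the one
  remaining piece (Gegenbauer/zonal-harmonic positivity, the content of the Wallach-set input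
  [FK94] of the printed proof), which is NOT proved in this file.

## References

* K.-H. Neeb, G. Ólafsson, J. Funct. Anal. 266 (2014) 2174–2224, arXiv:1206.2039, §6.2
  Prop. 6.2, Examples 2.3 and 6.4. [`NeebOlafsson2014`]
-/

noncomputable section

open scoped RealInnerProductSpace
open Finset ComplexConjugate

namespace Literature.Probability.LatticeModels

/-! ### Binomial-series coefficients -/

/-- `multichoose s k = s(s+1)⋯(s+k-1)/k! ≥ 0` for `s ≥ 0` (the binomial-series coefficients
of `(1 - x)^{-s}`). [folklore] -/
theorem multichoose_nonneg {s : ℝ} (hs : 0 ≤ s) (k : ℕ) : 0 ≤ Ring.multichoose s k := by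
  have h := Ring.factorial_nsmul_multichoose_eq_ascPochhammer s k
  rw [nsmul_eq_mul, Polynomial.ascPochhammer_smeval_eq_eval] at h
  have hpos : 0 ≤ (ascPochhammer ℝ k).eval s := by
    rcases hs.lt_or_eq with hs' | hs'
    · exact (ascPochhammer_pos k s hs').le
    · rw [← hs', ascPochhammer_eval_zero]; split_ifs <;> norm_num
  rw [← h] at hpos
  exact (mul_nonneg_iff_of_pos_left (by exact_mod_cast Nat.factorial_pos k)).1 hpos

/-- The real binomial series `(1 - u)^{-s} = Σ_k multichoose(s,k) u^k` for `|u| < 1`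
(Mathlib's `Real.one_div_one_sub_rpow_hasFPowerSeriesOnBall_zero`). [folklore] -/
theorem hasSum_one_sub_rpow_neg {s u : ℝ} (hu : |u| < 1) :
    HasSum (fun k : ℕ => Ring.multichoose s k * u ^ k) ((1 - u) ^ (-s)) := by
  have hp := Real.one_div_one_sub_rpow_hasFPowerSeriesOnBall_zero s
  have hmem : u ∈ Metric.eball (0 : ℝ) 1 := by
    simp [Metric.mem_eball, enorm_eq_nnnorm, ← NNReal.coe_lt_one, coe_nnnorm, Real.norm_eq_abs,
      hu]
  have h := hp.hasSum hmem
  simp only [FormalMultilinearSeries.ofScalars_apply_eq, smul_eq_mul, zero_add] at h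
  have h1 : 0 ≤ 1 - u := by linarith [(abs_lt.1 hu).2]
  rw [one_div, ← Real.rpow_neg h1] at h
  have hf : (fun k : ℕ => Ring.multichoose s k * u ^ k) =
      fun n : ℕ => Ring.choose (s + n - 1) n * u ^ n := by
    funext n; rw [Ring.multichoose_eq]
  rw [hf]
  exact h

/-! ### Sufficiency for `s = 0` and for `n = 1` -/

/-- **Prop. 6.2, sufficiency for `s = 0`**: the kernel is identically `1`, and the all-ones
matrix `1 1ᵀ` is positive semidefinite. [cite: NeebOlafsson2014, Prop. 6.2 (case s = 0)] -/
theorem ballKernel_posSemidef_exponent_zero {n : ℕ} {ι : Type*} [Fintype ι]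
    (x : ι → EuclideanSpace ℝ (Fin n)) :
    (Matrix.of fun a b : ι =>
      (1 - 2 * inner ℝ (x a) (x b) + ‖x a‖ ^ 2 * ‖x b‖ ^ 2) ^ (-(0 : ℝ) / 2)).PosSemidef := by
  have : (Matrix.of fun a b : ι =>
      (1 - 2 * inner ℝ (x a) (x b) + ‖x a‖ ^ 2 * ‖x b‖ ^ 2) ^ (-(0 : ℝ) / 2)) =
      Matrix.of fun _ _ : ι => (1 : ℝ) * ((1 : ℝ) * 1) := by
    ext a b
    simp
  rw [this]
  exact posSemidef_of_smul_gram zero_le_one fun _ => 1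

/-- **Prop. 6.2, sufficiency for `n = 1`** (Neeb–Ólafsson Example 2.3 / 6.4): on the interval
`(-1, 1)` the base is `(1 - t_a t_b)²`, so the kernel is
`(1 - t_a t_b)^{-s} = Σ_k multichoose(s,k) (t_a t_b)^k`, a nonnegative combination of Gram
kernels. [cite: NeebOlafsson2014, Prop. 6.2 and Example 2.3 (n = 1)] -/
theorem ballKernel_posSemidef_dim_one {s : ℝ} (hs : 0 ≤ s) {ι : Type*} [Fintype ι]
    (x : ι → EuclideanSpace ℝ (Fin 1)) (hx : ∀ a, ‖x a‖ < 1) :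
    (Matrix.of fun a b : ι =>
      (1 - 2 * inner ℝ (x a) (x b) + ‖x a‖ ^ 2 * ‖x b‖ ^ 2) ^ (-s / 2)).PosSemidef := by
  set t : ι → ℝ := fun a => x a 0 with ht
  have hinner : ∀ a b, inner ℝ (x a) (x b) = t a * t b := fun a b => by
    simp [PiLp.inner_apply, ht, mul_comm]
  have hnorm : ∀ a, ‖x a‖ ^ 2 = t a ^ 2 := fun a => by
    simp [EuclideanSpace.real_norm_sq_eq, ht]
  have htabs : ∀ a, |t a| < 1 := fun a => by
    have h1 : ‖x a‖ ^ 2 < 1 := by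
      have := hx a
      have h0 := norm_nonneg (x a)
      nlinarith
    rw [hnorm] at h1
    exact sq_lt_one_iff_abs_lt_one _ |>.1 h1
  have htt : ∀ a b, |t a * t b| < 1 := fun a b => by
    rw [abs_mul]
    exact mul_lt_one_of_nonneg_of_lt_one_left (abs_nonneg _) (htabs a) (htabs b).le
  have hentry : ∀ a b, (1 - 2 * inner ℝ (x a) (x b) + ‖x a‖ ^ 2 * ‖x b‖ ^ 2) ^ (-s / 2)
      = (1 - t a * t b) ^ (-s) := fun a b => by
    rw [hinner, hnorm, hnorm,
      show 1 - 2 * (t a * t b) + t a ^ 2 * t b ^ 2 = (1 - t a * t b) ^ 2 by ring]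
    exact sq_rpow_neg_half (by linarith [(abs_lt.1 (htt a b)).2])
  refine posSemidef_of_hasSum
    (N := fun k => Matrix.of fun a b : ι => Ring.multichoose s k * (t a ^ k * t b ^ k))
    (fun k => posSemidef_of_smul_gram (multichoose_nonneg hs k) _) fun a b => ?_
  rw [Matrix.of_apply, hentry]
  simpa [mul_pow] using hasSum_one_sub_rpow_neg (s := s) (htt a b)

/-! ### Sufficiency for `n = 2`: the disc kernel `|1 - z \bar w|^{-s}` -/

/-- The complex binomial series `(1 - w)^{-r} = Σ_k multichoose(r,k) w^k` for `‖w‖ < 1` and real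
`r` (Mathlib's `Complex.one_div_one_sub_cpow_hasFPowerSeriesOnBall_zero`). [folklore] -/
theorem hasSum_one_sub_cpow_neg (r : ℝ) {w : ℂ} (hw : ‖w‖ < 1) :
    HasSum (fun k : ℕ => ((Ring.multichoose r k : ℝ) : ℂ) * w ^ k) (1 / (1 - w) ^ (r : ℂ)) := by
  have hp := Complex.one_div_one_sub_cpow_hasFPowerSeriesOnBall_zero (r : ℂ)
  have hmem : w ∈ Metric.eball (0 : ℂ) 1 := by
    simp [Metric.mem_eball, enorm_eq_nnnorm, ← NNReal.coe_lt_one, coe_nnnorm, hw]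
  have h := hp.hasSum hmem
  simp only [FormalMultilinearSeries.ofScalars_apply_eq, smul_eq_mul, zero_add] at h
  have hf : (fun k : ℕ => ((Ring.multichoose r k : ℝ) : ℂ) * w ^ k) =
      fun n : ℕ => Ring.choose ((r : ℂ) + n - 1) n * w ^ n := by
    funext n
    rw [Ring.multichoose_eq, Complex.ofReal_choose]
    push_cast
    rfl
  rw [hf]
  exact h

/-- Absolute convergence of the complex binomial series inside the unit disc. [folklore] -/
theorem summable_norm_multichoose_mul_pow {r : ℝ} (hr : 0 ≤ r) {w : ℂ} (hw : ‖w‖ < 1) :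
    Summable (fun k : ℕ => ‖((Ring.multichoose r k : ℝ) : ℂ) * w ^ k‖) := by
  have h := (hasSum_one_sub_rpow_neg (s := r) (u := ‖w‖) (by rwa [abs_norm])).summable
  refine h.congr fun k => ?_
  rw [norm_mul, norm_pow, Complex.norm_real, Real.norm_eq_abs,
    abs_of_nonneg (multichoose_nonneg hr k)]

/-- Cauchy-type product of a power series with real coefficients and its conjugate:
`g(w) \bar{g(w)} = Σ_{k,l} d_k d_l w^k \bar w^l` (absolutely convergent case). [folklore] -/
theorem hasSum_mul_conj_of_hasSum {d : ℕ → ℝ} {w G : ℂ}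
    (h : HasSum (fun k : ℕ => (d k : ℂ) * w ^ k) G)
    (hs : Summable fun k : ℕ => ‖(d k : ℂ) * w ^ k‖) :
    HasSum (fun p : ℕ × ℕ => ((d p.1 * d p.2 : ℝ) : ℂ) * (w ^ p.1 * conj w ^ p.2))
      (G * conj G) := by
  have h2 : HasSum (fun k : ℕ => (d k : ℂ) * conj w ^ k) (conj G) := by
    have := (Complex.hasSum_conj' ).2 h
    simpa [map_mul, map_pow, Complex.conj_ofReal] using this
  have hs2 : Summable (fun k : ℕ => ‖(d k : ℂ) * conj w ^ k‖) := by
    simpa [norm_mul, norm_pow, Complex.norm_conj] using hs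
  have hprod := (summable_mul_of_summable_norm hs hs2 :)
  have h12 := (h.mul h2 hprod :)
  have hfun : (fun p : ℕ × ℕ => (d p.1 : ℂ) * w ^ p.1 * ((d p.2 : ℂ) * conj w ^ p.2)) =
      fun p : ℕ × ℕ => ((d p.1 * d p.2 : ℝ) : ℂ) * (w ^ p.1 * conj w ^ p.2) := by
    funext p
    push_cast
    ring
  rw [hfun] at h12
  exact h12

/-- The double series `|1 - w|^{-2r} = |(1 - w)^{-r}|² = Σ_{k,l} multichoose(r,k)
multichoose(r,l) w^k \bar w^l` for `‖w‖ < 1`, `r ≥ 0`. [folklore] -/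
theorem hasSum_norm_one_sub_rpow_neg {r : ℝ} (hr : 0 ≤ r) {w : ℂ} (hw : ‖w‖ < 1) :
    HasSum (fun p : ℕ × ℕ =>
      ((Ring.multichoose r p.1 * Ring.multichoose r p.2 : ℝ) : ℂ) * (w ^ p.1 * conj w ^ p.2))
      ((‖1 - w‖ ^ (-(2 * r)) : ℝ) : ℂ) := by
  have hpos : 0 < ‖1 - w‖ := by
    have : w ≠ 1 := fun h => by simp [h] at hw
    exact norm_pos_iff.2 (sub_ne_zero.2 (Ne.symm this))
  have hreal : ‖1 / (1 - w) ^ (r : ℂ)‖ ^ 2 = ‖1 - w‖ ^ (-(2 * r)) := by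
    rw [norm_div, norm_one, Complex.norm_cpow_real, div_pow, one_pow,
      ← Real.rpow_natCast (‖1 - w‖ ^ r) 2, ← Real.rpow_mul hpos.le, Real.rpow_neg hpos.le,
      one_div]
    congr 1
    push_cast
    ring_nf
  have hGG : 1 / (1 - w) ^ (r : ℂ) * conj (1 / (1 - w) ^ (r : ℂ)) =
      ((‖1 - w‖ ^ (-(2 * r)) : ℝ) : ℂ) := by
    rw [Complex.mul_conj, Complex.normSq_eq_norm_sq, hreal]
  rw [← hGG]
  exact hasSum_mul_conj_of_hasSum (hasSum_one_sub_cpow_neg r hw)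
    (summable_norm_multichoose_mul_pow hr hw)

/-- **The disc kernel `|1 - z_a \bar z_b|^{-2r}` is positive semidefinite** on the open unit
disc for every `r ≥ 0`: it is `|g(z_a \bar z_b)|²` with
`g = (1 - ·)^{-r} = Σ multichoose(r,k)(·)^k`, and `g \bar g` expands into a nonnegative
combination of the real Gram kernels built from `Re, Im (z^k \bar z^l)`. [folklore] -/
theorem posSemidef_norm_one_sub_mul_conj_rpow {r : ℝ} (hr : 0 ≤ r) {ι : Type*} [Fintype ι]
    (z : ι → ℂ) (hz : ∀ a, ‖z a‖ < 1) :
    (Matrix.of fun a b : ι => ‖1 - z a * conj (z b)‖ ^ (-(2 * r))).PosSemidef := by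
  have hw : ∀ a b, ‖z a * conj (z b)‖ < 1 := fun a b => by
    rw [norm_mul, Complex.norm_conj]
    exact mul_lt_one_of_nonneg_of_lt_one_left (norm_nonneg _) (hz a) (hz b).le
  refine posSemidef_of_hasSum
    (N := fun p : ℕ × ℕ =>
      (Matrix.of fun a b : ι => (Ring.multichoose r p.1 * Ring.multichoose r p.2) *
          ((z a ^ p.1 * conj (z a) ^ p.2).re * (z b ^ p.1 * conj (z b) ^ p.2).re)) +
        Matrix.of fun a b : ι => (Ring.multichoose r p.1 * Ring.multichoose r p.2) *
          ((z a ^ p.1 * conj (z a) ^ p.2).im * (z b ^ p.1 * conj (z b) ^ p.2).im))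
    (fun p => (posSemidef_of_smul_gram (mul_nonneg (multichoose_nonneg hr _)
      (multichoose_nonneg hr _)) _).add (posSemidef_of_smul_gram (mul_nonneg
        (multichoose_nonneg hr _) (multichoose_nonneg hr _)) _)) fun a b => ?_
  have hre := (Complex.hasSum_iff _ _ |>.1 (hasSum_norm_one_sub_rpow_neg hr (hw a b))).1
  rw [Complex.ofReal_re] at hre
  rw [Matrix.of_apply]
  convert hre using 1
  funext p
  simp only [Matrix.add_apply, Matrix.of_apply, mul_pow, map_mul]
  simp only [← map_pow, Complex.conj_conj, Complex.mul_re, Complex.mul_im, Complex.conj_re,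
    Complex.conj_im, Complex.ofReal_re, Complex.ofReal_im]
  ring

/-- **Prop. 6.2, sufficiency for `n = 2`** (Neeb–Ólafsson Example 6.4): in the complex
coordinate `z = x₀ + i x₁` the base is `|1 - z_a \bar z_b|²`, so the kernel is the disc
kernel `|1 - z_a \bar z_b|^{-s}` of `posSemidef_norm_one_sub_mul_conj_rpow`.
[cite: NeebOlafsson2014, Prop. 6.2 and Example 6.4 (n = 2)] -/
theorem ballKernel_posSemidef_dim_two {s : ℝ} (hs : 0 ≤ s) {ι : Type*} [Fintype ι]
    (x : ι → EuclideanSpace ℝ (Fin 2)) (hx : ∀ a, ‖x a‖ < 1) :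
    (Matrix.of fun a b : ι =>
      (1 - 2 * inner ℝ (x a) (x b) + ‖x a‖ ^ 2 * ‖x b‖ ^ 2) ^ (-s / 2)).PosSemidef := by
  let z : ι → ℂ := fun a => ⟨x a 0, x a 1⟩
  have hinner : ∀ a b, inner ℝ (x a) (x b) = (z a * conj (z b)).re := fun a b => by
    simp [PiLp.inner_apply, Fin.sum_univ_two, z, Complex.mul_re, mul_comm]
  have hnorm : ∀ a, ‖x a‖ ^ 2 = Complex.normSq (z a) := fun a => by
    rw [EuclideanSpace.real_norm_sq_eq]
    simp [Fin.sum_univ_two, z, Complex.normSq_apply, sq]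
  have hzlt : ∀ a, ‖z a‖ < 1 := fun a => by
    have h1 : ‖x a‖ ^ 2 < 1 := by
      have := hx a
      have h0 := norm_nonneg (x a)
      nlinarith
    rw [hnorm, Complex.normSq_eq_norm_sq] at h1
    exact (pow_lt_one_iff_of_nonneg (norm_nonneg _) two_ne_zero).1 h1
  have hbase : ∀ a b,
      1 - 2 * inner ℝ (x a) (x b) + ‖x a‖ ^ 2 * ‖x b‖ ^ 2 = ‖1 - z a * conj (z b)‖ ^ 2 :=
    fun a b => by
    rw [hinner, hnorm, hnorm, ← Complex.normSq_eq_norm_sq]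
    simp only [Complex.normSq_apply, Complex.mul_re, Complex.mul_im, Complex.conj_re,
      Complex.conj_im, Complex.sub_re, Complex.sub_im, Complex.one_re, Complex.one_im]
    ring
  have hM : (Matrix.of fun a b : ι =>
      (1 - 2 * inner ℝ (x a) (x b) + ‖x a‖ ^ 2 * ‖x b‖ ^ 2) ^ (-s / 2)) =
      Matrix.of fun a b : ι => ‖1 - z a * conj (z b)‖ ^ (-(2 * (s / 2))) := by
    ext a b
    rw [Matrix.of_apply, Matrix.of_apply, hbase, sq_rpow_neg_half (norm_nonneg _)]
    ring_nf
  rw [hM]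
  exact posSemidef_norm_one_sub_mul_conj_rpow (by linarith) z hzlt

/-! ### The fact in dimensions `n ≤ 2`, and the assembly -/

/-- **Neeb–Ólafsson 2014, Prop. 6.2 for `n ≤ 2` (both directions), PROVED**: for `n ∈ {1, 2}`
and `s ≥ 0` every finite kernel matrix is positive semidefinite (and the right-hand side
`s = 0 ∨ n − 2 ≤ s` holds trivially) — Example 6.4 of the paper.
[cite: NeebOlafsson2014, Prop. 6.2 and Example 6.4 (n = 1, 2)] -/
theorem neebOlafsson2014_ballKernel_posSemidef_iff_of_le_two (n : ℕ) (hn : 1 ≤ n)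
    (hn2 : n ≤ 2) (s : ℝ) (hs : 0 ≤ s) :
    (∀ (m : ℕ) (x : Fin m → EuclideanSpace ℝ (Fin n)), (∀ a, ‖x a‖ < 1) →
        (Matrix.of fun a b : Fin m =>
          (1 - 2 * inner ℝ (x a) (x b) + ‖x a‖ ^ 2 * ‖x b‖ ^ 2) ^ (-s / 2)).PosSemidef) ↔
      (s = 0 ∨ (n : ℝ) - 2 ≤ s) := by
  refine ⟨fun _ => Or.inr ?_, fun _ m x hx => ?_⟩
  · have : (n : ℝ) ≤ 2 := by exact_mod_cast hn2
    linarith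
  · interval_cases n
    · exact ballKernel_posSemidef_dim_one hs x hx
    · exact ballKernel_posSemidef_dim_two hs x hx

/-- **Assembly of Prop. 6.2 from its one remaining piece.** The named fact
`neebOlafsson2014_ballKernel_posSemidef_iff` follows from the proved halves
(`neebOlafsson2014_ballKernel_posSemidef_only_if`: necessity, all `n`;
`ballKernel_posSemidef_exponent_zero`, `…_dim_one`, `…_dim_two`: sufficiency for `s = 0` and
`n ≤ 2`) together with sufficiency in dimensions `n ≥ 3` for `s ≥ n − 2 > 0` — the
Gegenbauer/zonal-harmonic positivity that the printed proof imports from the Wallach set of the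
light cone [FK94]; that piece is the hypothesis `Hsuff` here and is NOT yet proved in the tree.
[cite: NeebOlafsson2014, Prop. 6.2 (§6.2, arXiv:1206.2039 p. 23)] -/
theorem neebOlafsson2014_ballKernel_posSemidef_iff_of_dim_ge_three_sufficiency
    (Hsuff : ∀ n : ℕ, 3 ≤ n → ∀ s : ℝ, (n : ℝ) - 2 ≤ s →
      ∀ (m : ℕ) (x : Fin m → EuclideanSpace ℝ (Fin n)), (∀ a, ‖x a‖ < 1) →
        (Matrix.of fun a b : Fin m =>
          (1 - 2 * inner ℝ (x a) (x b) + ‖x a‖ ^ 2 * ‖x b‖ ^ 2) ^ (-s / 2)).PosSemidef) :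
    neebOlafsson2014_ballKernel_posSemidef_iff := by
  intro n hn s hs
  refine ⟨neebOlafsson2014_ballKernel_posSemidef_only_if n s hs, fun h m x hx => ?_⟩
  rcases h with h0 | hle
  · subst h0
    exact ballKernel_posSemidef_exponent_zero x
  · by_cases hn2 : n ≤ 2
    · exact (neebOlafsson2014_ballKernel_posSemidef_iff_of_le_two n hn hn2 s hs).2
        (Or.inr hle) m x hx
    · exact Hsuff n (by omega) s hle m x hx

end Literature.Probability.LatticeModels

end
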